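import Summits.BirchSwinnertonDyer.BirchSwinnertonDyer.Theorems.ManinLocalTwoThreeTwoShiftTransferPair
import Summits.BirchSwinnertonDyer.BirchSwinnertonDyer.Theorems.ManinLocalTwoThreeCubeStep
import HarnessLib

/-!
# The 2-adic twin, transfer step III: the index-3 node — descent `Γ₀(2M) → Γ₀(M)` (`M` odd) by the transfer
# (route `ManinLocalTwoThree`, cell bsd-f2-manin; crux C2 `ManinOddAtFour` stmt-BirchSwinnertonDyer-22967; LEAD seat p1 gen 12;
# closes the «single index-3 node» of p3's law G₂ `TwoShift.TwoShiftInvariantIsDiamond` (`…TwoShiftLaws.lean`, ask A-p3-1))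

The `p = 2` twin of p3's `…CubeStep.lean` (E-es-103/104, `P¹(𝔽₃)`, index 4), for coefficients in any commutative ring `K` with
`2 = 0` and any unit eigenvalue `ε`.  Level `M` with `2 ∤ M`; `φ : Γ₀(2M) → K` additive with `φ(a, 2b; c, d) = ε φ(a, b; 2c, d)`
(`TwoShift.IsShiftEigen ε φ`).  With the pair `(coshift φ ε, restr φ)` of `…TwoShiftTransferPair.lean` and the section `sec` of the
orbit map at `0 ∈ P¹(𝔽₂)` (`sec [j:1] = T^j`, `sec ∞ = s := (δ, −1; M², 2)`, `2δ + M² = 1`), the TRANSFER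
`V g = Σₓ coshift φ ε (sec(g·x)⁻¹ g sec x)` of the coshift character from the index-3 subgroup `stabZero = Stab(0)` is additive on
`Γ₀(M)` and
* `V = restr φ` on `kerAct` (`3 ≡ 1 (mod 2)` and the conjugation invariance `restr_conj`);
* `V(T) = 0`: the cocycle of `T` has the values `1, T², s⁻¹Ts = (1+2M², 4; −M⁴, 1−2M²)`; the coshift kills `T²` (`φ(T) = 0`, as
  `φ(T²) = ε φ(T)` and `2 = 0`) and `s⁻¹Ts` (its coshift is `ε φ` of `(1+2M², 2; −2M⁴, 1−2M²)`, whose 2-shift partner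
  `(1+2M², 1; −4M⁴, 1−2M²) = u⁻¹ T u`, `u = (1 0; 2M² 1) ∈ Γ₀(2M)`, is killed by `φ`);
* hence `V = restr φ` on `stabInf = kerAct·⟨T⟩ = Γ₀(2M)` and, conjugating by `s` (`s·0 = ∞`), `V = coshift φ ε` on `stabZero`;
  so `w := V` is additive, restricts to `φ`, and is an `ε`-eigenfunction of the 2-shift.
Main results: `transfer_descent` (any `K`, `2 = 0`, unit `ε`), **`twoShiftTransferDescent`** (`K = 𝔽₂`, `ε = 1`: the exact twin of
E-es-103 `CubeStepDescent` — every 2-shift-invariant additive `φ : Γ₀(2M) → 𝔽₂` is the restriction of a 2-shift-invariant additive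
`w : Γ₀(M) → 𝔽₂`), `shiftEigenTransferDescent` (the ω-part twin), and the level laws
**`twoShiftInvariantIsDiamondAt_two_mul`** (`K₂(M) = D(M) ⟹ K₂(2M) = D(2M)`, `M` odd) and `shiftEigenTrivialAt_two_mul`.
No Bass–Serre theory, no presentation of `Γ₀(M)`.  Nothing about BSD, Manin's conjecture or C2 is proved here; G₂ itself is p3's
assembly.  Reference: cell memo HOME/MEMO-es.md §37.9 (the `p = 3` original); K. S. Brown, *Cohomology of Groups*, III.9
[cite: DarmonDiamondTaylor1995, Lemma 4.28 (p. 135) (shape: degeneracy maps on `Γ₀`)].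
-/

set_option autoImplicit false
set_option linter.dupNamespace false

open scoped MatrixGroups

open CongruenceSubgroup Matrix.SpecialLinearGroup
  Summit.BirchSwinnertonDyer.Rank1Residual.ManinAdditive.NineShiftEqualiser

namespace Summit.BirchSwinnertonDyer.BirchSwinnertonDyer.Theorems.ManinLocalTwoThree

namespace TwoShiftTransfer

open ThreeShiftDescent TwoShift
open CubeStep (tr transferSum transferSum_mul transferSum_eq_card_smul Tpow_one_zpow_any)

/-! ### §1. The section of the orbit map at `0` and the transfer `V` -/

section TransferV

variable {K : Type*} [CommRing K] {M : ℕ}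

/-- The action of `Γ₀(M)` on `P¹(𝔽₂)` through `SL(2, ℤ)`. [folklore] -/
def actG (γ : Gamma0 M) (ℓ : Option (ZMod 2)) : Option (ZMod 2) := act (γ : SL(2, ℤ)) ℓ

omit [CommRing K] in
/-- `actG` is an action. [folklore] -/
theorem actG_mul (g h : Gamma0 M) (x : Option (ZMod 2)) : actG (g * h) x = actG g (actG h x) := act_mul _ _ _

omit [CommRing K] in
/-- `1` acts trivially. [folklore] -/
theorem actG_one (x : Option (ZMod 2)) : actG (1 : Gamma0 M) x = x := act_one x

/-- The Bezout element `s = (δ, −1; M², 2)` (`2δ + M² = 1`), which maps `0 ↦ ∞`. [folklore] -/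
def sElt (M : ℕ) (δ : ℤ) (hδ : 2 * δ + (M : ℤ) * M = 1) : Gamma0 M :=
  g0Of δ (-1) ((M : ℤ) * M) 2 (by linear_combination hδ) (dvd_mul_right _ _)

omit [CommRing K] in
/-- `s·0 = ∞`. [folklore] -/
theorem act_sElt_zero (δ : ℤ) (hδ : 2 * δ + (M : ℤ) * M = 1) : act (sElt M δ hδ : SL(2, ℤ)) (some 0) = none := by
  rw [sElt, act_g0Of]
  simp only [vec, mul_zero, mul_one, zero_add, Int.cast_ofNat, Int.cast_neg, Int.cast_one]
  decide

omit [CommRing K] in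
/-- `s⁻¹·∞ = 0`. [folklore] -/
theorem act_sElt_inv_none (δ : ℤ) (hδ : 2 * δ + (M : ℤ) * M = 1) :
    act ((sElt M δ hδ)⁻¹ : SL(2, ℤ)) none = some 0 := by
  conv_lhs => rw [← act_sElt_zero δ hδ]
  rw [act_inv_act]

/-- The section of the orbit map `g ↦ g·0`: `[j:1] ↦ T^j`, `∞ ↦ s`. [folklore] -/
def sec (M : ℕ) (δ : ℤ) (hδ : 2 * δ + (M : ℤ) * M = 1) : Option (ZMod 2) → Gamma0 M
  | none => sElt M δ hδ
  | some j => Tpow M ((j.val : ℕ) : ℤ)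

omit [CommRing K] in
/-- `sec x · 0 = x`. [folklore] -/
theorem act_sec (δ : ℤ) (hδ : 2 * δ + (M : ℤ) * M = 1) (x : Option (ZMod 2)) :
    actG (sec M δ hδ x) (some 0) = x := by
  rcases x with _ | j
  · exact act_sElt_zero δ hδ
  · show act _ _ = _
    rw [sec, act_Tpow_some, zero_add, intCast_val]

variable (φ : Gamma0 (2 * M) → K) (ε : K) (δ : ℤ) (hδ : 2 * δ + (M : ℤ) * M = 1)

/-- **The transfer** of the coshift character from `stabZero = Stab(0)` to `Γ₀(M)`. [folklore] -/
noncomputable def V (g : Gamma0 M) : K := transferSum actG (sec M δ hδ) (coshift φ ε) g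

/-- `V` is additive on `Γ₀(M)`. [folklore] -/
theorem V_mul (hadd : IsAdd φ) (g h : Gamma0 M) :
    V φ ε δ hδ (g * h) = V φ ε δ hδ g + V φ ε δ hδ h :=
  transferSum_mul actG (sec M δ hδ) actG_mul actG_one (act_sec δ hδ)
    (fun u v hu hv => coshift_add φ ε hadd u hu v hv) g h

/-- `(2 + 1) • r = r` when `2 = 0` in `K`. [folklore] -/
theorem three_smul (h2 : (2 : K) = 0) (r : K) : (2 + 1) • r = r := by
  rw [add_nsmul, one_nsmul, two_nsmul, ← two_mul, h2, zero_mul, zero_add]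

/-- **`V = restr φ` on `kerAct`.** [folklore] -/
theorem V_of_mem_kerAct (h2 : (2 : K) = 0) (hM2 : ¬ 2 ∣ M) (hadd : IsAdd φ) (hinv : IsShiftEigen ε φ)
    {x : Gamma0 M} (hx : x ∈ kerAct M) : V φ ε δ hδ x = restr φ x := by
  have h : ∀ ℓ, coshift φ ε (tr actG (sec M δ hδ) x ℓ) = restr φ x := fun ℓ => by
    have e : tr actG (sec M δ hδ) x ℓ = (sec M δ hδ ℓ)⁻¹ * x * sec M δ hδ ℓ := by
      unfold tr
      rw [show actG x ℓ = ℓ from hx ℓ]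
    rw [e, coshift_eq_restr φ ε hM2 hinv _ (kerAct_inv_conj_mem _ hx)]
    simpa using restr_conj φ ε hM2 hadd hinv (sec M δ hδ ℓ)⁻¹ hx
  unfold V
  rw [transferSum_eq_card_smul actG (sec M δ hδ) h, Fintype.card_option, ZMod.card, three_smul h2]

/-- `φ(T) = 0` at level `2M` (the 2-shift of `T` is `T²`, and `ε` is a unit). [folklore] -/
theorem phi_Tpow_one (h2 : (2 : K) = 0) (hadd : IsAdd φ) (hε : IsUnit ε) (hinv : IsShiftEigen ε φ) :
    φ (Tpow (2 * M) 1) = 0 := by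
  have h := hinv 1 1 0 1 (by ring) (dvd_zero _)
  have e2 : (g0Of 1 (2 * 1) 0 1 (by ring) (dvd_zero _) : Gamma0 (2 * M)) = Tpow (2 * M) 1 ^ (2 : ℕ) := by
    rw [pow_two, Tpow_mul_Tpow]
    exact g0Of_congr rfl (by ring) rfl rfl _ _ _ _
  have e1 : (g0Of 1 1 (2 * 0) 1 (by ring) (Dvd.dvd.mul_left (dvd_zero _) 2) : Gamma0 (2 * M)) = Tpow (2 * M) 1 :=
    g0Of_congr rfl rfl (by ring) rfl _ _ _ _
  rw [e2, e1, hadd.map_pow, Nat.cast_ofNat, h2, zero_mul] at h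
  exact (hε.mul_right_eq_zero).mp h.symm

/-- `restr φ (T^k) = 0`. [folklore] -/
theorem restr_Tpow (hadd : IsAdd φ) (hT : φ (Tpow (2 * M) 1) = 0) (k : ℤ) : restr φ (Tpow M k) = 0 := by
  rw [Tpow, restr_g0Of φ 1 k 0 1 _ (dvd_zero _) (dvd_zero _), show (g0Of 1 k 0 1 _ _ : Gamma0 (2 * M)) =
    Tpow (2 * M) k from rfl, ← Tpow_one_zpow_any, addOn_map_zpow (H := ⊤) (fun x _ y _ => hadd x y)
    (Subgroup.mem_top _), hT, smul_zero]

/-- `coshift φ ε (T²) = ε φ(T) = 0`. [folklore] -/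
theorem coshift_Tpow_two (hT : φ (Tpow (2 * M) 1) = 0) : coshift φ ε (Tpow M 2) = 0 := by
  rw [show (Tpow M 2 : Gamma0 M) = g0Of 1 (2 * 1) 0 1 (by ring) (dvd_zero _) from g0Of_congr rfl (by ring) rfl rfl _ _ _ _,
    coshift_g0Of φ ε 1 1 0 1 _ _ (by ring) (dvd_zero _),
    show (g0Of 1 1 (2 * 0) 1 _ _ : Gamma0 (2 * M)) = Tpow (2 * M) 1 from g0Of_congr rfl rfl (by ring) rfl _ _ _ _, hT,
    mul_zero]

/-- The fixed-point value of the cocycle of `T`: `a₁ = s⁻¹ T s = (1 + 2M², 4; −M⁴, 1 − 2M²)`. [folklore] -/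
def aElt (M : ℕ) : Gamma0 M :=
  g0Of (1 + 2 * ((M : ℤ) * M)) (2 * 2) (-((M : ℤ) * M * ((M : ℤ) * M))) (1 - 2 * ((M : ℤ) * M)) (by ring)
    ⟨-((M : ℤ) * ((M : ℤ) * M)), by ring⟩

omit [CommRing K] in
/-- `s a₁ = T s`. [folklore] -/
theorem sElt_mul_aElt : sElt M δ hδ * aElt M = Tpow M 1 * sElt M δ hδ := by
  unfold sElt aElt Tpow
  rw [g0Of_mul _ _ _ _ _ _ _ _ _ _ _ _ (det_mul_entries (by linear_combination hδ) (by ring))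
      (dvd_add (Dvd.dvd.mul_right (dvd_mul_right _ _) _) (Dvd.dvd.mul_left ⟨-((M : ℤ) * ((M : ℤ) * M)), by ring⟩ _)),
    g0Of_mul _ _ _ _ _ _ _ _ _ _ _ _ (det_mul_entries (by ring) (by linear_combination hδ))
      (dvd_add (Dvd.dvd.mul_right (dvd_zero _) _) (Dvd.dvd.mul_left (dvd_mul_right _ _) _))]
  exact g0Of_congr (by linear_combination ((M : ℤ) * M) * hδ) (by linear_combination 2 * hδ) (by ring) (by ring)
    _ _ _ _

omit [CommRing K] in
/-- `s⁻¹ T s = a₁`. [folklore] -/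
theorem sElt_inv_conj_T : (sElt M δ hδ)⁻¹ * Tpow M 1 * sElt M δ hδ = aElt M := by
  rw [mul_assoc, inv_mul_eq_iff_eq_mul, sElt_mul_aElt]

/-- **The coshift kills `a₁`**: its 2-shift partner chain ends at `u⁻¹ T u`, `u = (1 0; 2M² 1) ∈ Γ₀(2M)`. [folklore] -/
theorem coshift_aElt (hadd : IsAdd φ) (hT : φ (Tpow (2 * M) 1) = 0) (hinv : IsShiftEigen ε φ) :
    coshift φ ε (aElt M) = 0 := by
  have hc3 : ((2 * M : ℕ) : ℤ) ∣ 2 * -((M : ℤ) * M * ((M : ℤ) * M)) := ⟨-((M : ℤ) * M * M), by push_cast; ring⟩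
  rw [aElt, coshift_g0Of φ ε _ 2 _ _ _ _ (by ring) hc3]
  -- the partner `(1+2M², 2; −2M⁴, 1−2M²) = (a, 2·1; c, d)` with `2M ∣ c`: apply the eigen-invariance once more
  have hc3' : ((2 * M : ℕ) : ℤ) ∣ -((M : ℤ) * (M * (M * M))) * 2 := ⟨-((M : ℤ) * M * M), by push_cast; ring⟩
  have step : (g0Of (1 + 2 * ((M : ℤ) * M)) 2 (2 * -((M : ℤ) * M * ((M : ℤ) * M))) (1 - 2 * ((M : ℤ) * M))
      (by ring) hc3 : Gamma0 (2 * M)) =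
      g0Of (1 + 2 * ((M : ℤ) * M)) (2 * 1) (-((M : ℤ) * (M * (M * M))) * 2) (1 - 2 * ((M : ℤ) * M))
        (by ring) hc3' := g0Of_congr rfl (by ring) (by ring) rfl _ _ _ _
  rw [step, hinv _ 1 _ _ (by ring) hc3']
  -- `u * partner' = T * u` with `u = (1 0; 2M² 1) ∈ Γ₀(2M)`
  have hu3 : ((2 * M : ℕ) : ℤ) ∣ 2 * ((M : ℤ) * M) := ⟨(M : ℤ), by push_cast; ring⟩
  have key : (g0Of 1 0 (2 * ((M : ℤ) * M)) 1 (by ring) hu3 : Gamma0 (2 * M)) *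
      g0Of (1 + 2 * ((M : ℤ) * M)) 1 (2 * (-((M : ℤ) * (M * (M * M))) * 2)) (1 - 2 * ((M : ℤ) * M))
        (by ring) (Dvd.dvd.mul_left hc3' 2) =
      Tpow (2 * M) 1 * g0Of 1 0 (2 * ((M : ℤ) * M)) 1 (by ring) hu3 := by
    rw [Tpow, g0Of_mul _ _ _ _ _ _ _ _ _ _ _ _ (det_mul_entries (by ring) (by ring))
        (dvd_add (Dvd.dvd.mul_right hu3 _) (Dvd.dvd.mul_left (Dvd.dvd.mul_left hc3' 2) _)),
      g0Of_mul _ _ _ _ _ _ _ _ _ _ _ _ (det_mul_entries (by ring) (by ring))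
        (dvd_add (Dvd.dvd.mul_right (dvd_zero _) _) (Dvd.dvd.mul_left hu3 _))]
    exact g0Of_congr (by ring) (by ring) (by ring) (by ring) _ _ _ _
  have hP := eq_inv_mul_iff_mul_eq.mpr key
  have hinv1 : φ (g0Of 1 0 (2 * ((M : ℤ) * M)) 1 (by ring) hu3)⁻¹ + φ (g0Of 1 0 (2 * ((M : ℤ) * M)) 1 (by ring) hu3) =
      0 := by
    rw [← hadd, inv_mul_cancel, hadd.map_one]
  rw [hP, hadd, hadd, hT, zero_add, hinv1, mul_zero, mul_zero]

omit [CommRing K] in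
/-- Values in `ZMod 2` used to evaluate the cocycle of `T`. [folklore] -/
theorem zmod2_vals : ((0 : ZMod 2) + 1).val = 1 ∧ ((1 : ZMod 2) + 1).val = 0 ∧
    (0 : ZMod 2).val = 0 ∧ (1 : ZMod 2).val = 1 := by
  decide

omit [CommRing K] in
/-- The cocycle of `T` at a finite point `[j:1]`: `T^{−(j+1).val + 1 + j.val}`. [folklore] -/
theorem tr_T_some (j : ZMod 2) :
    tr actG (sec M δ hδ) (Tpow M 1) (some j) =
      Tpow M (-(((j + 1 : ZMod 2).val : ℕ) : ℤ) + 1 + ((j.val : ℕ) : ℤ)) := by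
  unfold tr
  rw [show actG (Tpow M 1) (some j) = some (j + 1) by rw [actG, act_Tpow_some, Int.cast_one]]
  simp only [sec]
  rw [Tpow_inv, Tpow_mul_Tpow, Tpow_mul_Tpow]

omit [CommRing K] in
/-- The cocycle of `T` at `∞`: `s⁻¹ T s = a₁`. [folklore] -/
theorem tr_T_none : tr actG (sec M δ hδ) (Tpow M 1) none = aElt M := by
  unfold tr
  rw [show actG (Tpow M 1) none = none from act_Tpow_none 1]
  exact sElt_inv_conj_T δ hδ

omit [CommRing K] in
/-- The cocycle of `T` at `[0:1]` is `1`. [folklore] -/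
theorem tr_T_zero : tr actG (sec M δ hδ) (Tpow M 1) (some 0) = 1 := by
  rw [tr_T_some, zmod2_vals.1, zmod2_vals.2.2.1]
  norm_num
  exact Tpow_zero

omit [CommRing K] in
/-- The cocycle of `T` at `[1:1]` is `T²`. [folklore] -/
theorem tr_T_one : tr actG (sec M δ hδ) (Tpow M 1) (some 1) = Tpow M 2 := by
  rw [tr_T_some, zmod2_vals.2.1, zmod2_vals.2.2.2]
  norm_num

/-- A sum over `ZMod 2`. [folklore] -/
theorem sum_zmod2 (f : ZMod 2 → K) : ∑ j, f j = f 0 + f 1 := Fin.sum_univ_two f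

/-- **`V(T) = 0`.** [folklore] -/
theorem V_Tpow_one (hadd : IsAdd φ) (hT : φ (Tpow (2 * M) 1) = 0) (hinv : IsShiftEigen ε φ) :
    V φ ε δ hδ (Tpow M 1) = 0 := by
  have h0 : coshift φ ε (1 : Gamma0 M) = 0 := addOn_map_one (coshift_add φ ε hadd)
  unfold V transferSum
  rw [Fintype.sum_option, sum_zmod2, tr_T_none, tr_T_zero, tr_T_one, coshift_aElt φ ε hadd hT hinv, h0,
    coshift_Tpow_two φ ε hT]
  norm_num

/-- `V(T^k) = 0`. [folklore] -/
theorem V_Tpow (hadd : IsAdd φ) (hT : φ (Tpow (2 * M) 1) = 0) (hinv : IsShiftEigen ε φ) (k : ℤ) :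
    V φ ε δ hδ (Tpow M k) = 0 := by
  rw [← Tpow_one_zpow_any, addOn_map_zpow (H := ⊤) (fun x _ y _ => V_mul φ ε δ hδ hadd x y) (Subgroup.mem_top _),
    V_Tpow_one φ ε δ hδ hadd hT hinv, smul_zero]

/-- **`V = restr φ` on `stabInf = Γ₀(2M)`.** [folklore] -/
theorem V_of_mem_stabInf (h2 : (2 : K) = 0) (hM2 : ¬ 2 ∣ M) (hadd : IsAdd φ) (hT : φ (Tpow (2 * M) 1) = 0)
    (hinv : IsShiftEigen ε φ) {b : Gamma0 M} (hb : b ∈ stabInf M) : V φ ε δ hδ b = restr φ b := by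
  obtain ⟨k, c, hc, rfl⟩ := exists_kerAct_mul_Tpow hb
  rw [V_mul φ ε δ hδ hadd, V_of_mem_kerAct φ ε δ hδ h2 hM2 hadd hinv hc, V_Tpow φ ε δ hδ hadd hT hinv,
    restr_add φ hM2 hadd c (stabInf_of_kerAct hc) _ (Tpow_mem_stabInf k), restr_Tpow φ hadd hT]

omit [CommRing K] in
/-- `a₁ ∈ stabZero`. [folklore] -/
theorem aElt_mem_stabZero : aElt M ∈ stabZero M := by
  unfold aElt
  exact g0Of_mem_stabZero _ 2 _ _ _ _

/-- **`V = coshift φ ε` on `stabZero`** (conjugate into `stabInf` by `s`). [folklore] -/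
theorem V_of_mem_stabZero (h2 : (2 : K) = 0) (hM2 : ¬ 2 ∣ M) (hadd : IsAdd φ) (hT : φ (Tpow (2 * M) 1) = 0)
    (hinv : IsShiftEigen ε φ) {a : Gamma0 M} (ha : a ∈ stabZero M) : V φ ε δ hδ a = coshift φ ε a := by
  have hb : sElt M δ hδ * a * (sElt M δ hδ)⁻¹ ∈ stabInf M := by
    rw [mem_stabInf, Subgroup.coe_mul, Subgroup.coe_mul, act_mul, act_mul, Subgroup.coe_inv,
      act_sElt_inv_none δ hδ, mem_stabZero.mp ha, act_sElt_zero δ hδ]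
  obtain ⟨k, c, hc, hdec⟩ := exists_kerAct_mul_Tpow hb
  have hcs : (sElt M δ hδ)⁻¹ * c * sElt M δ hδ ∈ kerAct M := kerAct_inv_conj_mem _ hc
  -- `s⁻¹ T^k s = a₁^k` and `a = (s⁻¹ c s) · a₁^k`
  have hpow : (sElt M δ hδ)⁻¹ * Tpow M k * sElt M δ hδ = aElt M ^ k := by
    rw [← sElt_inv_conj_T δ hδ, ← Tpow_one_zpow_any]
    have h := (conj_zpow (a := (sElt M δ hδ)⁻¹) (b := Tpow M 1) (i := k)).symm
    rwa [inv_inv] at h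
  have ha' : a = ((sElt M δ hδ)⁻¹ * c * sElt M δ hδ) * aElt M ^ k := by
    have e : a = (sElt M δ hδ)⁻¹ * (sElt M δ hδ * a * (sElt M δ hδ)⁻¹) * sElt M δ hδ := by group
    rw [e, hdec, ← hpow]
    group
  -- the value of `V`
  have hVconj : V φ ε δ hδ (sElt M δ hδ * a * (sElt M δ hδ)⁻¹) = V φ ε δ hδ a := by
    rw [V_mul φ ε δ hδ hadd, V_mul φ ε δ hδ hadd,
      addOn_map_inv (H := ⊤) (fun x _ y _ => V_mul φ ε δ hδ hadd x y) (Subgroup.mem_top _)]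
    abel
  have hV : V φ ε δ hδ a = restr φ c := by
    rw [← hVconj, V_of_mem_stabInf φ ε δ hδ h2 hM2 hadd hT hinv hb, hdec,
      restr_add φ hM2 hadd c (stabInf_of_kerAct hc) _ (Tpow_mem_stabInf k), restr_Tpow φ hadd hT, add_zero]
  -- the value of `coshift`
  have hC : coshift φ ε a = restr φ c := by
    rw [ha', coshift_add φ ε hadd _ (stabZero_of_kerAct hcs) _ ((stabZero M).zpow_mem aElt_mem_stabZero k),
      addOn_map_zpow (coshift_add φ ε hadd) aElt_mem_stabZero k, coshift_aElt φ ε hadd hT hinv, smul_zero,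
      add_zero, coshift_eq_restr φ ε hM2 hinv _ hcs]
    simpa using restr_conj φ ε hM2 hadd hinv (sElt M δ hδ)⁻¹ hc
  rw [hV, hC]

end TransferV

/-! ### §2. The transfer step `Γ₀(2M) → Γ₀(M)`, `M` odd -/

section Main

variable {K : Type*} [CommRing K] {M : ℕ}

/-- **THE TRANSFER STEP, any coefficients with `2 = 0`, any unit eigenvalue.**  For `2 ∤ M` and `φ : Γ₀(2M) → K` additive with
`φ(a, 2b; c, d) = ε φ(a, b; 2c, d)` (`2M ∣ c`), the transfer `w = V` is additive on `Γ₀(M)`, satisfies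
`w(a, 2b; c, d) = ε w(a, b; 2c, d)` (`M ∣ c`), and restricts to `φ`. [new: the index-3 transfer, twin of p3's cube step] -/
theorem transfer_descent (h2 : (2 : K) = 0) (hM2 : ¬ 2 ∣ M) (φ : Gamma0 (2 * M) → K) (ε : K) (hε : IsUnit ε)
    (hadd : IsAdd φ) (hinv : IsShiftEigen ε φ) :
    ∃ w : Gamma0 M → K, IsAdd w ∧ IsShiftEigen ε w ∧ RestrictsFrom φ w := by
  obtain ⟨δ, hδ⟩ := exists_delta hM2
  have hT := phi_Tpow_one φ ε h2 hadd hε hinv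
  refine ⟨V φ ε δ hδ, fun g h => V_mul φ ε δ hδ hadd g h, ?_, ?_⟩
  · intro a b c d hdet hc
    rw [V_of_mem_stabZero φ ε δ hδ h2 hM2 hadd hT hinv (g0Of_mem_stabZero a b c d (by linear_combination hdet) hc),
      coshift_g0Of φ ε a b c d _ hc hdet (dvd_two_mul' hc),
      V_of_mem_stabInf φ ε δ hδ h2 hM2 hadd hT hinv (g0Of_mem_stabInf hM2 a b (2 * c) d hdet _ (dvd_two_mul' hc)),
      restr_g0Of φ a b (2 * c) d hdet _ (dvd_two_mul' hc)]
  · intro a b c d hdet hcN hcM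
    rw [V_of_mem_stabInf φ ε δ hδ h2 hM2 hadd hT hinv (g0Of_mem_stabInf hM2 a b c d hdet hcM hcN),
      restr_g0Of φ a b c d hdet hcM hcN]

/-- **The ω-part twin** (any `K` with `2 = 0`, unit `ε`), in the `(M, N, N = 2M)` shape of the cell's step nodes: every additive
`ε`-eigenfunction of the 2-shift on `Γ₀(2M)`, `M` odd, is the restriction of one on `Γ₀(M)`. [new] -/
theorem shiftEigenTransferDescent (h2 : (2 : K) = 0) (ε : K) (hε : IsUnit ε) :
    ∀ (M N : ℕ), 0 < M → ¬ 2 ∣ M → N = 2 * M → ∀ φ : Gamma0 N → K, IsAdd φ → IsShiftEigen ε φ →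
      ∃ w : Gamma0 M → K, IsAdd w ∧ IsShiftEigen ε w ∧ RestrictsFrom φ w := by
  intro M N _ hM2 hN φ hadd hinv
  subst hN
  exact transfer_descent h2 hM2 φ ε hε hadd hinv

/-- **THE INDEX-3 NODE of G₂** (the exact `p = 2` twin of E-es-103 `CubeStepDescent`): for `M` odd, every additive
2-shift-invariant `φ : Γ₀(2M) → 𝔽₂` is the restriction of an additive 2-shift-invariant `w : Γ₀(M) → 𝔽₂`
(`K₂(2M) = res K₂(M)`). [new: the index-3 transfer, twin of p3's cube step] -/
theorem twoShiftTransferDescent :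
    ∀ (M N : ℕ), 0 < M → ¬ 2 ∣ M → N = 2 * M → ∀ φ : Gamma0 N → ZMod 2, IsAdd φ → IsTwoShiftInvariant φ →
      ∃ w : Gamma0 M → ZMod 2, IsAdd w ∧ IsTwoShiftInvariant w ∧ RestrictsFrom φ w := by
  intro M N _ hM2 hN φ hadd hinv
  subst hN
  have h2 : (2 : ZMod 2) = 0 := by decide
  obtain ⟨w, hw, hwinv, hres⟩ := transfer_descent h2 hM2 φ 1 isUnit_one hadd
    ((isTwoShiftInvariant_iff_isShiftEigen_one φ).mp hinv)
  exact ⟨w, hw, (isTwoShiftInvariant_iff_isShiftEigen_one w).mpr hwinv, hres⟩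

/-- **Level law: `K₂(M) = D(M) ⟹ K₂(2M) = D(2M)` for `M` odd** (G₂ climbs the index-3 step): restriction of a diamond class is
diamond (p3's `isDiamond_of_restrictsFrom`). [new] -/
theorem twoShiftInvariantIsDiamondAt_two_mul (hM : 0 < M) (hM2 : ¬ 2 ∣ M) (hbase : TwoShiftInvariantIsDiamondAt M) :
    TwoShiftInvariantIsDiamondAt (2 * M) := by
  intro φ hadd hinv
  obtain ⟨w, hw, hwinv, hres⟩ := twoShiftTransferDescent M (2 * M) hM hM2 rfl φ hadd hinv
  exact isDiamond_of_restrictsFrom (dvd_mul_left M 2) hres (hbase w hw hwinv)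

/-- **Level law for eigenfunctions: `K^ε(M) = 0 ⟹ K^ε(2M) = 0` for `M` odd** (`2 = 0` in `K`, unit `ε`; the ω-part climbs
the index-3 step). [new] -/
theorem shiftEigenTrivialAt_two_mul (h2 : (2 : K) = 0) (ε : K) (hε : IsUnit ε) (hM2 : ¬ 2 ∣ M)
    (hbase : ShiftEigenTrivialAt M ε) : ShiftEigenTrivialAt (2 * M) ε := by
  intro φ hadd hinv γ
  obtain ⟨w, hw, hwinv, hres⟩ := transfer_descent h2 hM2 φ ε hε hadd hinv
  exact TwoShift.eq_zero_of_restrictsFrom (dvd_mul_left M 2) hres (hbase w hw hwinv) γ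

end Main

end TwoShiftTransfer

end Summit.BirchSwinnertonDyer.BirchSwinnertonDyer.Theorems.ManinLocalTwoThree
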